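import Summits.AtomisticToContinuum.Crystallization.Theorems.FrustratedLawDichotomyPalmStress
import Summits.AtomisticToContinuum.Crystallization.Theorems.FrustratedLawDichotomyAperiodicGapDenseDifferences

/-!
# FrustratedLawDichotomy · crux `AperiodicFrustratedLawGap` (stmt-AtomisticToContinuum-27623) — THE STRESS CUT AND THE CORE OF RECORD
# (decomp-a2c, prover hand 2, structural share, generation 2)

* `aperiodicFrustratedLawGap_iff_shearFree` — granted the floor of item 9229 (hypothesis `hU`), the crux (route decl, BY NAME) is
  EQUIVALENT to its restriction to laws with ZERO PALM STRESS TENSOR: `E_P[Σ_y (‖y‖⁻⁸ − ‖y‖⁻¹⁴)⟨y, H y⟩] = 0` for every `H ∈ End(ℝ³)`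
  (`FrustratedLawDichotomyPalmStress.palmStress_of_minimising`);
* `aperiodicFrustratedLawGap_iff_core` — **THE CORE OF RECORD** after hand 2's generations 0 and 2: granted the floor, the crux is
  EQUIVALENT to its restriction to laws which are almost surely carried by configurations with a 2-RELATIVELY-DENSE DIFFERENCE SET
  (`aperiodicFrustratedLawGap_iff_denseDifferences`, generation 0 — in particular infinite, no slabs, no rods), have ZERO PALM PRESSURE
  (`∫∫ ‖y‖⁻⁶ = ∫∫ ‖y‖⁻¹²`, `E_P[rootEnergy] = −(1/24) ∫∫ ‖y‖⁻¹²`), are STABLE UNDER EVERY LINEAR DEFORMATION `A ∈ GL₃(ℝ)` and have ZERO PALM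
  STRESS TENSOR — all five extra hypotheses at once;
* `aperiodicErgodicGap_iff_core` — the corresponding cut of the REGISTERED STUB `stub_aperiodicErgodicGap` (statement `S_aperiodicErgodicGap`
  of the skeleton `Cruxes/AperiodicFrustratedLawGap` verbatim on the left), with the infinite-configuration clause of
  `FrustratedLawDichotomyFiniteClusterGap.aperiodicErgodicGap_iff_infiniteCase` in place of the dense-difference clause.

Texture, Nash, aperiodicity and ergodicity remain idle: the open content of the crux is a quantitative energy price for everywhere-1/20-bad
textured configurations, which none of these necessary conditions supplies.  All `[folklore]`.
-/

noncomputable section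

namespace Summit.AtomisticToContinuum.Crystallization.Theorems.FrustratedLawDichotomyAperiodicGapVirialCut

open MeasureTheory
open Summit.AtomisticToContinuum.Crystallization.Theorems.FrustratedLawDichotomyVirial (virial_of_minimising')
open Summit.AtomisticToContinuum.Crystallization.Theorems.FrustratedLawDichotomyLinearImages (eStar_le_integral_linearDeformed)
open Summit.AtomisticToContinuum.Crystallization.Theorems.FrustratedLawDichotomyPalmStress (palmStress_of_minimising)
open Summit.AtomisticToContinuum.Crystallization.Theorems.FrustratedLawDichotomyAperiodicGapFiniteCut (aperiodicFrustratedLawGap_iff_denseDifferences)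
open Summit.AtomisticToContinuum.Crystallization.Theorems.FrustratedLawDichotomyFiniteClusterGap (aperiodicErgodicGap_iff_infiniteCase)

/-- **STRESS CUT OF THE CRUX.**  Granted the floor of item 9229, `AperiodicFrustratedLawGap` (by name) is EQUIVALENT to its restriction to laws
with zero Palm stress tensor, `E_P[Σ_y (‖y‖⁻⁸ − ‖y‖⁻¹⁴)⟨y, H y⟩] = 0` for all `H ∈ End(ℝ³)` (its statement verbatim with this extra hypothesis).
[folklore] -/
theorem aperiodicFrustratedLawGap_iff_shearFree
    (hU : ∀ δ' : ℝ, 0 < δ' → ∀ Q : MeasureTheory.Measure (MeasureTheory.Measure (EuclideanSpace ℝ (Fin 3))), MeasureTheory.IsProbabilityMeasure Q →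
      (∀ᵐ μ ∂Q, Literature.Probability.Process.IsRootedHardCore δ' μ) → Literature.Probability.Process.IsPointStationaryLaw Q →
      (⨅ Q : Literature.MathematicalPhysics.StatisticalMechanics.PeriodicConfiguration 3, Q.energyPerParticle Literature.MathematicalPhysics.StatisticalMechanics.lennardJones) ≤
        ∫ μ, Literature.MathematicalPhysics.StatisticalMechanics.rootEnergy Literature.MathematicalPhysics.StatisticalMechanics.lennardJones μ ∂Q) :
    Summit.AtomisticToContinuum.Crystallization.Theses.FrustratedLawDichotomy.AperiodicFrustratedLawGap ↔
    (∀ δ : ℝ, 0 < δ → ∀ P : MeasureTheory.Measure (MeasureTheory.Measure (EuclideanSpace ℝ (Fin 3))), let Gy : ℝ → (N : ℕ) → (Fin N → EuclideanSpace ℝ (Fin 3)) → Fin N → Prop := fun η N y j => let d : ℝ := sInf ((fun z => dist z (y (j : Fin N))) '' (Set.range (y) \ {(y (j : Fin N))})); let T : Set (EuclideanSpace ℝ (Fin 3)) := {z : EuclideanSpace ℝ (Fin 3) | z ∈ Set.range (y) ∧ z ≠ (y (j : Fin N)) ∧ dist z (y (j : Fin N)) < 13 / 10 * d}; ∃ A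 : EuclideanSpace ℝ (Fin 3) →ₗᵢ[ℝ] EuclideanSpace ℝ (Fin 3), (∃ e : ↥T ≃ ↥Literature.Geometry.DiscreteGeometry.fccKissingPattern, ∀ t : ↥T, dist (d⁻¹ • ((t : EuclideanSpace ℝ (Fin 3)) - (y (j : Fin N)))) (A ((e t : ↥Literature.Geometry.DiscreteGeometry.fccKissingPattern) : EuclideanSpace ℝ (Fin 3))) ≤ η) ∨ (∃ e : ↥T ≃ ↥Literature.Geometry.DiscreteGeometry.hcpKissingPattern, ∀ t : ↥T, dist (d⁻¹ • ((t : EuclideanSpace ℝ (Fin 3)) - (y (j : Fin N)))) (A ((e t : ↥Literature.Geometry.DiscreteGeometry.hcpKissingPattern) : EuclideanSpace ℝ (Fin 3))) ≤ η); let TexBall : (N : ℕ) → (Fin N → EuclideanSpace ℝ (Fin 3)) → Fin N → ℝ → ℝ → ℝ → ℝ → Prop := fun N y i R R₇ R₈ R₉ => (∀ a b : Fin N, a ≠ b → (7 : ℝ) / 10 ≤ dist (y a) (y b)) ∧ (∀ j : Fin N, dist (y j) (y i) ≤ R → ¬ Gy (1 / 20) N (y) j) ∧ (∀ j : Fin N,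 dist (y j) (y i) ≤ R → ¬ ((∀ j' : Fin N, dist (y j') (y j) ≤ R₇ → ¬ Gy (1 / 20) N (y) j') ∧ (∀ z : EuclideanSpace ℝ (Fin 3), dist z (y j) ≤ R₇ → ∃ k : Fin N, dist z (y k) ≤ 1) ∧ (∀ j' : Fin N, dist (y j') (y j) ≤ R₇ → (let d : ℝ := sInf ((fun z => dist z (y j')) '' (Set.range (y) \ {(y j')})); ∀ k : Fin N, y k ≠ y j' → dist (y k) (y j') < 27 / 20 * d → 5 ≤ Nat.card {m : Fin N // y m ≠ y j' ∧ dist (y m) (y j') < 27 / 20 * d ∧ y m ≠ y k ∧ dist (y m) (y k) < 27 / 20 * d})))) ∧ (∀ j : Fin N, dist (y j) (y i) ≤ R → ∃ k : Fin N, dist (y k) (y j) ≤ R₈ ∧ Gy (1 / 8) N (y) k) ∧ (∀ j : Fin N, dist (y j) (y i) ≤ R → ¬ ((∀ j' : Fin N, dist (y j') (y j) ≤ R₉ → ¬ Gy (1 / 20) N (y) j') ∧ (Nat.card {j' : Fin N // dist (y j') (y j) ≤ R₉ ∧ ¬ Gy (1 / 8) N (y) j'} : ℝ) ≤ 1 /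 2 * (Nat.card {j' : Fin N // dist (y j') (y j) ≤ R₉} : ℝ) ∧ (∀ j' : Fin N, dist (y j') (y j) ≤ R₉ → ¬ Gy (1 / 8) N (y) j' → ¬ (let d : ℝ := sInf ((fun z => dist z (y j')) '' (Set.range (y) \ {(y j')})); ∀ k : Fin N, y k ≠ y j' → dist (y k) (y j') < 27 / 20 * d → 5 ≤ Nat.card {m : Fin N // y m ≠ y j' ∧ dist (y m) (y j') < 27 / 20 * d ∧ y m ≠ y k ∧ dist (y m) (y k) < 27 / 20 * d})))); let Appr : MeasureTheory.Measure (EuclideanSpace ℝ (Fin 3)) → ℝ → ℝ → ℝ → Prop := fun μ R₇ R₈ R₉ => ∀ q : EuclideanSpace ℝ (Fin 3), μ {q} ≠ 0 → ∀ R ε : ℝ, 0 < ε → ∃ (N : ℕ) (y : Fin N → EuclideanSpace ℝ (Fin 3)) (i : Fin N), TexBall N y i R R₇ R₈ R₉ ∧ (∀ p : EuclideanSpace ℝ (Fin 3), μ {p} ≠ 0 → dist p q ≤ R → ∃ k : Fin N, dist (y k - y i) (p - q) ≤ ε) ∧ (∀ k : Fin N, dist (y k) (y i) ≤ R → ∃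 p : EuclideanSpace ℝ (Fin 3), μ {p} ≠ 0 ∧ dist (y k - y i) (p - q) ≤ ε); MeasureTheory.IsProbabilityMeasure P → (∀ᵐ μ ∂P, Literature.Probability.Process.IsRootedHardCore δ μ) → Literature.Probability.Process.IsPointStationaryLaw P → (∃ R₇ R₈ R₉ : ℝ, ∀ᵐ μ ∂P, Appr μ R₇ R₈ R₉) → (∀ᵐ μ ∂P, ∀ p : EuclideanSpace ℝ (Fin 3), μ {p} ≠ 0 → ∀ y : EuclideanSpace ℝ (Fin 3), (∀ q : EuclideanSpace ℝ (Fin 3), μ {q} ≠ 0 → q ≠ p → y ≠ q) → ∑' q : {q : EuclideanSpace ℝ (Fin 3) // μ {q} ≠ 0 ∧ q ≠ p}, Literature.MathematicalPhysics.StatisticalMechanics.lennardJones (dist p (q : EuclideanSpace ℝ (Fin 3))) ≤ ∑' q : {q : EuclideanSpace ℝ (Fin 3) // μ {q} ≠ 0 ∧ q ≠ p}, Literature.MathematicalPhysics.StatisticalMechanics.lennardJones (dist y (q : EuclideanSpace ℝ (Fin 3)))) → P {μ : MeasureTheory.Measure (EuclideanSpace ℝ (Fin 3)) | ∃ Q :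 Literature.MathematicalPhysics.StatisticalMechanics.PeriodicConfiguration 3, ∃ t : EuclideanSpace ℝ (Fin 3), {p : EuclideanSpace ℝ (Fin 3) | μ {p} ≠ 0} = (fun s => s + t) '' Q.points} = 0 → (∀ Hm : EuclideanSpace ℝ (Fin 3) →L[ℝ] EuclideanSpace ℝ (Fin 3), (∫ μ, ∫ y, (‖y‖⁻¹ ^ 8 - ‖y‖⁻¹ ^ 14) * inner ℝ y (Hm y) ∂μ ∂P) = 0) → (⨅ Q : Literature.MathematicalPhysics.StatisticalMechanics.PeriodicConfiguration 3, Q.energyPerParticle Literature.MathematicalPhysics.StatisticalMechanics.lennardJones) < (∫ μ, Literature.MathematicalPhysics.StatisticalMechanics.rootEnergy Literature.MathematicalPhysics.StatisticalMechanics.lennardJones μ ∂P)) := by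
  constructor
  · intro h δ hδ P
    have h' := h δ hδ P
    dsimp only at h' ⊢
    intro hP ha hb hd he h0 _
    exact h' hP ha hb hd he h0
  · intro h δ hδ P
    have h' := h δ hδ P
    dsimp only at h' ⊢
    intro hP ha hb hd he h0
    by_contra hlt
    exact hlt (h' hP ha hb hd he h0 fun Hm => palmStress_of_minimising hU hδ ha hb (not_lt.mp hlt) Hm)

/-- **THE CORE OF RECORD (hand 2, generations 0 + 2).**  Granted the floor of item 9229, `AperiodicFrustratedLawGap` (by name) is EQUIVALENT to
its restriction to laws that are (i) almost surely carried by configurations with a 2-relatively-dense difference set, (ii) of zero Palm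
pressure, (iii) with `E_P[rootEnergy] = −(1/24) ∫∫ ‖y‖⁻¹²`, (iv) stable under every `A ∈ GL₃(ℝ)`, (v) of zero Palm stress tensor
(its statement verbatim with these five extra hypotheses). [folklore] -/
theorem aperiodicFrustratedLawGap_iff_core
    (hU : ∀ δ' : ℝ, 0 < δ' → ∀ Q : MeasureTheory.Measure (MeasureTheory.Measure (EuclideanSpace ℝ (Fin 3))), MeasureTheory.IsProbabilityMeasure Q →
      (∀ᵐ μ ∂Q, Literature.Probability.Process.IsRootedHardCore δ' μ) → Literature.Probability.Process.IsPointStationaryLaw Q →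
      (⨅ Q : Literature.MathematicalPhysics.StatisticalMechanics.PeriodicConfiguration 3, Q.energyPerParticle Literature.MathematicalPhysics.StatisticalMechanics.lennardJones) ≤
        ∫ μ, Literature.MathematicalPhysics.StatisticalMechanics.rootEnergy Literature.MathematicalPhysics.StatisticalMechanics.lennardJones μ ∂Q) :
    Summit.AtomisticToContinuum.Crystallization.Theses.FrustratedLawDichotomy.AperiodicFrustratedLawGap ↔
    (∀ δ : ℝ, 0 < δ → ∀ P : MeasureTheory.Measure (MeasureTheory.Measure (EuclideanSpace ℝ (Fin 3))), let Gy : ℝ → (N : ℕ) → (Fin N → EuclideanSpace ℝ (Fin 3)) → Fin N → Prop := fun η N y j => let d : ℝ := sInf ((fun z => dist z (y (j : Fin N))) '' (Set.range (y) \ {(y (j : Fin N))})); let T : Set (EuclideanSpace ℝ (Fin 3)) := {z : EuclideanSpace ℝ (Fin 3) | z ∈ Set.range (y) ∧ z ≠ (y (j : Fin N)) ∧ dist z (y (j : Fin N)) < 13 / 10 * d}; ∃ A : EuclideanSpace ℝ (Fin 3) →ₗᵢ[ℝ] EuclideanSpace ℝ (Fin 3), (∃ e : ↥T ≃ ↥Literature.Geometry.DiscreteGeometry.fccKissingPattern,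 ∀ t : ↥T, dist (d⁻¹ • ((t : EuclideanSpace ℝ (Fin 3)) - (y (j : Fin N)))) (A ((e t : ↥Literature.Geometry.DiscreteGeometry.fccKissingPattern) : EuclideanSpace ℝ (Fin 3))) ≤ η) ∨ (∃ e : ↥T ≃ ↥Literature.Geometry.DiscreteGeometry.hcpKissingPattern, ∀ t : ↥T, dist (d⁻¹ • ((t : EuclideanSpace ℝ (Fin 3)) - (y (j : Fin N)))) (A ((e t : ↥Literature.Geometry.DiscreteGeometry.hcpKissingPattern) : EuclideanSpace ℝ (Fin 3))) ≤ η); let TexBall : (N : ℕ) → (Fin N → EuclideanSpace ℝ (Fin 3)) → Fin N → ℝ → ℝ → ℝ → ℝ → Prop := fun N y i R R₇ R₈ R₉ => (∀ a b : Fin N, a ≠ b → (7 : ℝ) / 10 ≤ dist (y a) (y b)) ∧ (∀ j : Fin N, dist (y j) (y i) ≤ R → ¬ Gy (1 / 20) N (y) j) ∧ (∀ j : Fin N, dist (y j) (y i) ≤ R → ¬ ((∀ j' : Fin N, dist (y j') (y j) ≤ R₇ → ¬ Gy (1 / 20) N (y) j') ∧ (∀ z : EuclideanSpace ℝ (Fin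 3), dist z (y j) ≤ R₇ → ∃ k : Fin N, dist z (y k) ≤ 1) ∧ (∀ j' : Fin N, dist (y j') (y j) ≤ R₇ → (let d : ℝ := sInf ((fun z => dist z (y j')) '' (Set.range (y) \ {(y j')})); ∀ k : Fin N, y k ≠ y j' → dist (y k) (y j') < 27 / 20 * d → 5 ≤ Nat.card {m : Fin N // y m ≠ y j' ∧ dist (y m) (y j') < 27 / 20 * d ∧ y m ≠ y k ∧ dist (y m) (y k) < 27 / 20 * d})))) ∧ (∀ j : Fin N, dist (y j) (y i) ≤ R → ∃ k : Fin N, dist (y k) (y j) ≤ R₈ ∧ Gy (1 / 8) N (y) k) ∧ (∀ j : Fin N, dist (y j) (y i) ≤ R → ¬ ((∀ j' : Fin N, dist (y j') (y j) ≤ R₉ → ¬ Gy (1 / 20) N (y) j') ∧ (Nat.card {j' : Fin N // dist (y j') (y j) ≤ R₉ ∧ ¬ Gy (1 / 8) N (y) j'} : ℝ) ≤ 1 / 2 * (Nat.card {j' : Fin N // dist (y j') (y j) ≤ R₉} : ℝ) ∧ (∀ j' : Fin N, dist (y j') (y j) ≤ R₉ → ¬ Gy (1 / 8) N (y) j' →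 ¬ (let d : ℝ := sInf ((fun z => dist z (y j')) '' (Set.range (y) \ {(y j')})); ∀ k : Fin N, y k ≠ y j' → dist (y k) (y j') < 27 / 20 * d → 5 ≤ Nat.card {m : Fin N // y m ≠ y j' ∧ dist (y m) (y j') < 27 / 20 * d ∧ y m ≠ y k ∧ dist (y m) (y k) < 27 / 20 * d})))); let Appr : MeasureTheory.Measure (EuclideanSpace ℝ (Fin 3)) → ℝ → ℝ → ℝ → Prop := fun μ R₇ R₈ R₉ => ∀ q : EuclideanSpace ℝ (Fin 3), μ {q} ≠ 0 → ∀ R ε : ℝ, 0 < ε → ∃ (N : ℕ) (y : Fin N → EuclideanSpace ℝ (Fin 3)) (i : Fin N), TexBall N y i R R₇ R₈ R₉ ∧ (∀ p : EuclideanSpace ℝ (Fin 3), μ {p} ≠ 0 → dist p q ≤ R → ∃ k : Fin N, dist (y k - y i) (p - q) ≤ ε) ∧ (∀ k : Fin N, dist (y k) (y i) ≤ R → ∃ p : EuclideanSpace ℝ (Fin 3), μ {p} ≠ 0 ∧ dist (y k - y i) (p - q) ≤ ε); MeasureTheory.IsProbabilityMeasure P → (∀ᵐ μ ∂P, Literature.Probability.Process.IsRootedHardCore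 δ μ) → Literature.Probability.Process.IsPointStationaryLaw P → (∃ R₇ R₈ R₉ : ℝ, ∀ᵐ μ ∂P, Appr μ R₇ R₈ R₉) → (∀ᵐ μ ∂P, ∀ p : EuclideanSpace ℝ (Fin 3), μ {p} ≠ 0 → ∀ y : EuclideanSpace ℝ (Fin 3), (∀ q : EuclideanSpace ℝ (Fin 3), μ {q} ≠ 0 → q ≠ p → y ≠ q) → ∑' q : {q : EuclideanSpace ℝ (Fin 3) // μ {q} ≠ 0 ∧ q ≠ p}, Literature.MathematicalPhysics.StatisticalMechanics.lennardJones (dist p (q : EuclideanSpace ℝ (Fin 3))) ≤ ∑' q : {q : EuclideanSpace ℝ (Fin 3) // μ {q} ≠ 0 ∧ q ≠ p}, Literature.MathematicalPhysics.StatisticalMechanics.lennardJones (dist y (q : EuclideanSpace ℝ (Fin 3)))) → P {μ : MeasureTheory.Measure (EuclideanSpace ℝ (Fin 3)) | ∃ Q : Literature.MathematicalPhysics.StatisticalMechanics.PeriodicConfiguration 3, ∃ t : EuclideanSpace ℝ (Fin 3), {p : EuclideanSpace ℝ (Fin 3) | μ {p} ≠ 0} = (fun s => s + t) '' Q.points}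 = 0 → (∀ᵐ μ ∂P, ∀ v : EuclideanSpace ℝ (Fin 3), ∀ ε : ℝ, 0 < ε → ∃ s s' : EuclideanSpace ℝ (Fin 3), μ {s} ≠ 0 ∧ μ {s'} ≠ 0 ∧ ‖s - s' + v‖ < 2 + ε) → (∫ μ, ∫ y, ‖y‖⁻¹ ^ 6 ∂μ ∂P = ∫ μ, ∫ y, ‖y‖⁻¹ ^ 12 ∂μ ∂P) → ((∫ μ, Literature.MathematicalPhysics.StatisticalMechanics.rootEnergy Literature.MathematicalPhysics.StatisticalMechanics.lennardJones μ ∂P) = -(1 / 24) * ∫ μ, ∫ y, ‖y‖⁻¹ ^ 12 ∂μ ∂P) → (∀ A : EuclideanSpace ℝ (Fin 3) ≃L[ℝ] EuclideanSpace ℝ (Fin 3), (∫ μ, Literature.MathematicalPhysics.StatisticalMechanics.rootEnergy Literature.MathematicalPhysics.StatisticalMechanics.lennardJones μ ∂P) ≤ ∫ μ, (∫ y, Literature.MathematicalPhysics.StatisticalMechanics.lennardJones ‖A y‖ ∂μ) / 2 ∂P) → (∀ Hm : EuclideanSpace ℝ (Fin 3) →L[ℝ] EuclideanSpace ℝ (Fin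 3), (∫ μ, ∫ y, (‖y‖⁻¹ ^ 8 - ‖y‖⁻¹ ^ 14) * inner ℝ y (Hm y) ∂μ ∂P) = 0) → (⨅ Q : Literature.MathematicalPhysics.StatisticalMechanics.PeriodicConfiguration 3, Q.energyPerParticle Literature.MathematicalPhysics.StatisticalMechanics.lennardJones) < (∫ μ, Literature.MathematicalPhysics.StatisticalMechanics.rootEnergy Literature.MathematicalPhysics.StatisticalMechanics.lennardJones μ ∂P)) := by
  constructor
  · intro h δ hδ P
    have h' := h δ hδ P
    dsimp only at h' ⊢
    intro hP ha hb hd he h0 _ _ _ _ _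
    exact h' hP ha hb hd he h0
  · intro h
    rw [aperiodicFrustratedLawGap_iff_denseDifferences hU]
    intro δ hδ P
    have h' := h δ hδ P
    dsimp only at h' ⊢
    intro hP ha hb hd he h0 hD
    by_contra hlt
    obtain ⟨h₁, h₂, -⟩ := virial_of_minimising' hU hδ ha hb (not_lt.mp hlt)
    exact hlt (h' hP ha hb hd he h0 hD h₁ h₂ (fun A => (not_lt.mp hlt).trans (eStar_le_integral_linearDeformed hU hδ ha hb A))
      fun Hm => palmStress_of_minimising hU hδ ha hb (not_lt.mp hlt) Hm)

/-- **THE CORE OF RECORD AT THE REGISTERED STUB** `stub_aperiodicErgodicGap` (statement `S_aperiodicErgodicGap` verbatim on the left): granted the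
floor, the ergodic aperiodic gap is EQUIVALENT to its restriction to ERGODIC laws almost surely carried by INFINITE configurations, of zero
Palm pressure, with `E_P[rootEnergy] = −(1/24) ∫∫ ‖y‖⁻¹²`, stable under every `A ∈ GL₃(ℝ)` and of zero Palm stress tensor. [folklore] -/
theorem aperiodicErgodicGap_iff_core
    (hU : ∀ δ' : ℝ, 0 < δ' → ∀ Q : MeasureTheory.Measure (MeasureTheory.Measure (EuclideanSpace ℝ (Fin 3))), MeasureTheory.IsProbabilityMeasure Q →
      (∀ᵐ μ ∂Q, Literature.Probability.Process.IsRootedHardCore δ' μ) → Literature.Probability.Process.IsPointStationaryLaw Q →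
      (⨅ Q : Literature.MathematicalPhysics.StatisticalMechanics.PeriodicConfiguration 3, Q.energyPerParticle Literature.MathematicalPhysics.StatisticalMechanics.lennardJones) ≤
        ∫ μ, Literature.MathematicalPhysics.StatisticalMechanics.rootEnergy Literature.MathematicalPhysics.StatisticalMechanics.lennardJones μ ∂Q) :
    (∀ δ : ℝ, 0 < δ → ∀ P : MeasureTheory.Measure (MeasureTheory.Measure (EuclideanSpace ℝ (Fin 3))), let Gy : ℝ → (N : ℕ) → (Fin N → EuclideanSpace ℝ (Fin 3)) → Fin N → Prop := fun η N y j => let d : ℝ := sInf ((fun z => dist z (y (j : Fin N))) '' (Set.range (y) \ {(y (j : Fin N))})); let T : Set (EuclideanSpace ℝ (Fin 3)) := {z : EuclideanSpace ℝ (Fin 3) | z ∈ Set.range (y) ∧ z ≠ (y (j : Fin N)) ∧ dist z (y (j : Fin N)) < 13 / 10 * d}; ∃ A : EuclideanSpace ℝ (Fin 3) →ₗᵢ[ℝ] EuclideanSpace ℝ (Fin 3), (∃ e : ↥T ≃ ↥Literature.Geometry.DiscreteGeometry.fccKissingPattern, ∀ t : ↥T, dist (d⁻¹ • ((t : EuclideanSpace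 ℝ (Fin 3)) - (y (j : Fin N)))) (A ((e t : ↥Literature.Geometry.DiscreteGeometry.fccKissingPattern) : EuclideanSpace ℝ (Fin 3))) ≤ η) ∨ (∃ e : ↥T ≃ ↥Literature.Geometry.DiscreteGeometry.hcpKissingPattern, ∀ t : ↥T, dist (d⁻¹ • ((t : EuclideanSpace ℝ (Fin 3)) - (y (j : Fin N)))) (A ((e t : ↥Literature.Geometry.DiscreteGeometry.hcpKissingPattern) : EuclideanSpace ℝ (Fin 3))) ≤ η); let TexBall : (N : ℕ) → (Fin N → EuclideanSpace ℝ (Fin 3)) → Fin N → ℝ → ℝ → ℝ → ℝ → Prop := fun N y i R R₇ R₈ R₉ => (∀ a b : Fin N, a ≠ b → (7 : ℝ) / 10 ≤ dist (y a) (y b)) ∧ (∀ j : Fin N, dist (y j) (y i) ≤ R → ¬ Gy (1 / 20) N (y) j) ∧ (∀ j : Fin N, dist (y j) (y i) ≤ R → ¬ ((∀ j' : Fin N, dist (y j') (y j) ≤ R₇ → ¬ Gy (1 / 20) N (y) j') ∧ (∀ z : EuclideanSpace ℝ (Fin 3), dist z (y j) ≤ R₇ → ∃ k : Fin N, dist z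 (y k) ≤ 1) ∧ (∀ j' : Fin N, dist (y j') (y j) ≤ R₇ → (let d : ℝ := sInf ((fun z => dist z (y j')) '' (Set.range (y) \ {(y j')})); ∀ k : Fin N, y k ≠ y j' → dist (y k) (y j') < 27 / 20 * d → 5 ≤ Nat.card {m : Fin N // y m ≠ y j' ∧ dist (y m) (y j') < 27 / 20 * d ∧ y m ≠ y k ∧ dist (y m) (y k) < 27 / 20 * d})))) ∧ (∀ j : Fin N, dist (y j) (y i) ≤ R → ∃ k : Fin N, dist (y k) (y j) ≤ R₈ ∧ Gy (1 / 8) N (y) k) ∧ (∀ j : Fin N, dist (y j) (y i) ≤ R → ¬ ((∀ j' : Fin N, dist (y j') (y j) ≤ R₉ → ¬ Gy (1 / 20) N (y) j') ∧ (Nat.card {j' : Fin N // dist (y j') (y j) ≤ R₉ ∧ ¬ Gy (1 / 8) N (y) j'} : ℝ) ≤ 1 / 2 * (Nat.card {j' : Fin N // dist (y j') (y j) ≤ R₉} : ℝ) ∧ (∀ j' : Fin N, dist (y j') (y j) ≤ R₉ → ¬ Gy (1 / 8) N (y) j' → ¬ (let d : ℝ := sInf ((fun z => dist z (y j')) ''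 (Set.range (y) \ {(y j')})); ∀ k : Fin N, y k ≠ y j' → dist (y k) (y j') < 27 / 20 * d → 5 ≤ Nat.card {m : Fin N // y m ≠ y j' ∧ dist (y m) (y j') < 27 / 20 * d ∧ y m ≠ y k ∧ dist (y m) (y k) < 27 / 20 * d})))); let Appr : MeasureTheory.Measure (EuclideanSpace ℝ (Fin 3)) → ℝ → ℝ → ℝ → Prop := fun μ R₇ R₈ R₉ => ∀ q : EuclideanSpace ℝ (Fin 3), μ {q} ≠ 0 → ∀ R ε : ℝ, 0 < ε → ∃ (N : ℕ) (y : Fin N → EuclideanSpace ℝ (Fin 3)) (i : Fin N), TexBall N y i R R₇ R₈ R₉ ∧ (∀ p : EuclideanSpace ℝ (Fin 3), μ {p} ≠ 0 → dist p q ≤ R → ∃ k : Fin N, dist (y k - y i) (p - q) ≤ ε) ∧ (∀ k : Fin N, dist (y k) (y i) ≤ R → ∃ p : EuclideanSpace ℝ (Fin 3), μ {p} ≠ 0 ∧ dist (y k - y i) (p - q) ≤ ε); MeasureTheory.IsProbabilityMeasure P → (∀ᵐ μ ∂P, Literature.Probability.Process.IsRootedHardCore δ μ) → Literature.Probability.Process.IsPointStationaryLaw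 P → (∃ R₇ R₈ R₉ : ℝ, ∀ᵐ μ ∂P, Appr μ R₇ R₈ R₉) → (∀ᵐ μ ∂P, ∀ p : EuclideanSpace ℝ (Fin 3), μ {p} ≠ 0 → ∀ y : EuclideanSpace ℝ (Fin 3), (∀ q : EuclideanSpace ℝ (Fin 3), μ {q} ≠ 0 → q ≠ p → y ≠ q) → ∑' q : {q : EuclideanSpace ℝ (Fin 3) // μ {q} ≠ 0 ∧ q ≠ p}, Literature.MathematicalPhysics.StatisticalMechanics.lennardJones (dist p (q : EuclideanSpace ℝ (Fin 3))) ≤ ∑' q : {q : EuclideanSpace ℝ (Fin 3) // μ {q} ≠ 0 ∧ q ≠ p}, Literature.MathematicalPhysics.StatisticalMechanics.lennardJones (dist y (q : EuclideanSpace ℝ (Fin 3)))) → P {μ : MeasureTheory.Measure (EuclideanSpace ℝ (Fin 3)) | ∃ Q : Literature.MathematicalPhysics.StatisticalMechanics.PeriodicConfiguration 3, ∃ t : EuclideanSpace ℝ (Fin 3), {p : EuclideanSpace ℝ (Fin 3) | μ {p} ≠ 0} = (fun s => s + t) '' Q.points} = 0 → (∀ A : Set (MeasureTheory.Measure (EuclideanSpace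 ℝ (Fin 3))), MeasurableSet A → (∀ μ : MeasureTheory.Measure (EuclideanSpace ℝ (Fin 3)), ∀ p : EuclideanSpace ℝ (Fin 3), μ {p} ≠ 0 → (μ ∈ A ↔ MeasureTheory.Measure.map (fun z : EuclideanSpace ℝ (Fin 3) => z - p) μ ∈ A)) → P A = 0 ∨ P Aᶜ = 0) → (⨅ Q : Literature.MathematicalPhysics.StatisticalMechanics.PeriodicConfiguration 3, Q.energyPerParticle Literature.MathematicalPhysics.StatisticalMechanics.lennardJones) < (∫ μ, Literature.MathematicalPhysics.StatisticalMechanics.rootEnergy Literature.MathematicalPhysics.StatisticalMechanics.lennardJones μ ∂P)) ↔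
    (∀ δ : ℝ, 0 < δ → ∀ P : MeasureTheory.Measure (MeasureTheory.Measure (EuclideanSpace ℝ (Fin 3))), let Gy : ℝ → (N : ℕ) → (Fin N → EuclideanSpace ℝ (Fin 3)) → Fin N → Prop := fun η N y j => let d : ℝ := sInf ((fun z => dist z (y (j : Fin N))) '' (Set.range (y) \ {(y (j : Fin N))})); let T : Set (EuclideanSpace ℝ (Fin 3)) := {z : EuclideanSpace ℝ (Fin 3) | z ∈ Set.range (y) ∧ z ≠ (y (j : Fin N)) ∧ dist z (y (j : Fin N)) < 13 / 10 * d}; ∃ A : EuclideanSpace ℝ (Fin 3) →ₗᵢ[ℝ] EuclideanSpace ℝ (Fin 3), (∃ e : ↥T ≃ ↥Literature.Geometry.DiscreteGeometry.fccKissingPattern, ∀ t : ↥T, dist (d⁻¹ • ((t : EuclideanSpace ℝ (Fin 3)) - (y (j : Fin N)))) (A ((e t : ↥Literature.Geometry.DiscreteGeometry.fccKissingPattern) : EuclideanSpace ℝ (Fin 3))) ≤ η) ∨ (∃ e : ↥T ≃ ↥Literature.Geometry.DiscreteGeometry.hcpKissingPattern, ∀ t : ↥T, dist (d⁻¹ •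 ((t : EuclideanSpace ℝ (Fin 3)) - (y (j : Fin N)))) (A ((e t : ↥Literature.Geometry.DiscreteGeometry.hcpKissingPattern) : EuclideanSpace ℝ (Fin 3))) ≤ η); let TexBall : (N : ℕ) → (Fin N → EuclideanSpace ℝ (Fin 3)) → Fin N → ℝ → ℝ → ℝ → ℝ → Prop := fun N y i R R₇ R₈ R₉ => (∀ a b : Fin N, a ≠ b → (7 : ℝ) / 10 ≤ dist (y a) (y b)) ∧ (∀ j : Fin N, dist (y j) (y i) ≤ R → ¬ Gy (1 / 20) N (y) j) ∧ (∀ j : Fin N, dist (y j) (y i) ≤ R → ¬ ((∀ j' : Fin N, dist (y j') (y j) ≤ R₇ → ¬ Gy (1 / 20) N (y) j') ∧ (∀ z : EuclideanSpace ℝ (Fin 3), dist z (y j) ≤ R₇ → ∃ k : Fin N, dist z (y k) ≤ 1) ∧ (∀ j' : Fin N, dist (y j') (y j) ≤ R₇ → (let d : ℝ := sInf ((fun z => dist z (y j')) '' (Set.range (y) \ {(y j')})); ∀ k : Fin N, y k ≠ y j' → dist (y k) (y j') < 27 / 20 * d → 5 ≤ Nat.card {m : Fin N // y m ≠ y j'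 ∧ dist (y m) (y j') < 27 / 20 * d ∧ y m ≠ y k ∧ dist (y m) (y k) < 27 / 20 * d})))) ∧ (∀ j : Fin N, dist (y j) (y i) ≤ R → ∃ k : Fin N, dist (y k) (y j) ≤ R₈ ∧ Gy (1 / 8) N (y) k) ∧ (∀ j : Fin N, dist (y j) (y i) ≤ R → ¬ ((∀ j' : Fin N, dist (y j') (y j) ≤ R₉ → ¬ Gy (1 / 20) N (y) j') ∧ (Nat.card {j' : Fin N // dist (y j') (y j) ≤ R₉ ∧ ¬ Gy (1 / 8) N (y) j'} : ℝ) ≤ 1 / 2 * (Nat.card {j' : Fin N // dist (y j') (y j) ≤ R₉} : ℝ) ∧ (∀ j' : Fin N, dist (y j') (y j) ≤ R₉ → ¬ Gy (1 / 8) N (y) j' → ¬ (let d : ℝ := sInf ((fun z => dist z (y j')) '' (Set.range (y) \ {(y j')})); ∀ k : Fin N, y k ≠ y j' → dist (y k) (y j') < 27 / 20 * d → 5 ≤ Nat.card {m : Fin N // y m ≠ y j' ∧ dist (y m) (y j') < 27 / 20 * d ∧ y m ≠ y k ∧ dist (y m) (y k) < 27 / 20 * d})))); let Appr : MeasureTheory.Measure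 (EuclideanSpace ℝ (Fin 3)) → ℝ → ℝ → ℝ → Prop := fun μ R₇ R₈ R₉ => ∀ q : EuclideanSpace ℝ (Fin 3), μ {q} ≠ 0 → ∀ R ε : ℝ, 0 < ε → ∃ (N : ℕ) (y : Fin N → EuclideanSpace ℝ (Fin 3)) (i : Fin N), TexBall N y i R R₇ R₈ R₉ ∧ (∀ p : EuclideanSpace ℝ (Fin 3), μ {p} ≠ 0 → dist p q ≤ R → ∃ k : Fin N, dist (y k - y i) (p - q) ≤ ε) ∧ (∀ k : Fin N, dist (y k) (y i) ≤ R → ∃ p : EuclideanSpace ℝ (Fin 3), μ {p} ≠ 0 ∧ dist (y k - y i) (p - q) ≤ ε); MeasureTheory.IsProbabilityMeasure P → (∀ᵐ μ ∂P, Literature.Probability.Process.IsRootedHardCore δ μ) → Literature.Probability.Process.IsPointStationaryLaw P → (∃ R₇ R₈ R₉ : ℝ, ∀ᵐ μ ∂P, Appr μ R₇ R₈ R₉) → (∀ᵐ μ ∂P, ∀ p : EuclideanSpace ℝ (Fin 3), μ {p} ≠ 0 → ∀ y : EuclideanSpace ℝ (Fin 3), (∀ q : EuclideanSpace ℝ (Fin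 3), μ {q} ≠ 0 → q ≠ p → y ≠ q) → ∑' q : {q : EuclideanSpace ℝ (Fin 3) // μ {q} ≠ 0 ∧ q ≠ p}, Literature.MathematicalPhysics.StatisticalMechanics.lennardJones (dist p (q : EuclideanSpace ℝ (Fin 3))) ≤ ∑' q : {q : EuclideanSpace ℝ (Fin 3) // μ {q} ≠ 0 ∧ q ≠ p}, Literature.MathematicalPhysics.StatisticalMechanics.lennardJones (dist y (q : EuclideanSpace ℝ (Fin 3)))) → P {μ : MeasureTheory.Measure (EuclideanSpace ℝ (Fin 3)) | ∃ Q : Literature.MathematicalPhysics.StatisticalMechanics.PeriodicConfiguration 3, ∃ t : EuclideanSpace ℝ (Fin 3), {p : EuclideanSpace ℝ (Fin 3) | μ {p} ≠ 0} = (fun s => s + t) '' Q.points} = 0 → (∀ A : Set (MeasureTheory.Measure (EuclideanSpace ℝ (Fin 3))), MeasurableSet A → (∀ μ : MeasureTheory.Measure (EuclideanSpace ℝ (Fin 3)), ∀ p : EuclideanSpace ℝ (Fin 3), μ {p} ≠ 0 → (μ ∈ A ↔ MeasureTheory.Measure.map (fun z : EuclideanSpace ℝ (Fin 3) => z - p)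 μ ∈ A)) → P A = 0 ∨ P Aᶜ = 0) → (∀ᵐ μ ∂P, {p : EuclideanSpace ℝ (Fin 3) | μ {p} ≠ 0}.Infinite) → (∫ μ, ∫ y, ‖y‖⁻¹ ^ 6 ∂μ ∂P = ∫ μ, ∫ y, ‖y‖⁻¹ ^ 12 ∂μ ∂P) → ((∫ μ, Literature.MathematicalPhysics.StatisticalMechanics.rootEnergy Literature.MathematicalPhysics.StatisticalMechanics.lennardJones μ ∂P) = -(1 / 24) * ∫ μ, ∫ y, ‖y‖⁻¹ ^ 12 ∂μ ∂P) → (∀ A : EuclideanSpace ℝ (Fin 3) ≃L[ℝ] EuclideanSpace ℝ (Fin 3), (∫ μ, Literature.MathematicalPhysics.StatisticalMechanics.rootEnergy Literature.MathematicalPhysics.StatisticalMechanics.lennardJones μ ∂P) ≤ ∫ μ, (∫ y, Literature.MathematicalPhysics.StatisticalMechanics.lennardJones ‖A y‖ ∂μ) / 2 ∂P) → (∀ Hm : EuclideanSpace ℝ (Fin 3) →L[ℝ] EuclideanSpace ℝ (Fin 3), (∫ μ, ∫ y, (‖y‖⁻¹ ^ 8 - ‖y‖⁻¹ ^ 14)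 * inner ℝ y (Hm y) ∂μ ∂P) = 0) → (⨅ Q : Literature.MathematicalPhysics.StatisticalMechanics.PeriodicConfiguration 3, Q.energyPerParticle Literature.MathematicalPhysics.StatisticalMechanics.lennardJones) < (∫ μ, Literature.MathematicalPhysics.StatisticalMechanics.rootEnergy Literature.MathematicalPhysics.StatisticalMechanics.lennardJones μ ∂P)) := by
  constructor
  · intro h δ hδ P
    have h' := h δ hδ P
    dsimp only at h' ⊢
    intro hP ha hb hd he h0 herg _ _ _ _ _
    exact h' hP ha hb hd he h0 herg
  · intro h
    rw [aperiodicErgodicGap_iff_infiniteCase]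
    intro δ hδ P
    have h' := h δ hδ P
    dsimp only at h' ⊢
    intro hP ha hb hd he h0 herg hinf
    by_contra hlt
    obtain ⟨h₁, h₂, -⟩ := virial_of_minimising' hU hδ ha hb (not_lt.mp hlt)
    exact hlt (h' hP ha hb hd he h0 herg hinf h₁ h₂ (fun A => (not_lt.mp hlt).trans (eStar_le_integral_linearDeformed hU hδ ha hb A))
      fun Hm => palmStress_of_minimising hU hδ ha hb (not_lt.mp hlt) Hm)

end Summit.AtomisticToContinuum.Crystallization.Theorems.FrustratedLawDichotomyAperiodicGapVirialCut

end
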